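import Summits.QuantumFields.YangMills.Theorems.TwistedTraceScaling.Negative.TensorGapCeiling
import HarnessLib

/-!
# R61B — the BO STIFF BLOCK constant of lane A's `tensorForm_boOrth_le` cannot be lowered: `ρ` admissible iff `∀ k, r_k ≤ ρ`; no `L`-uniform `ρ < 1`
(crux `TwistedTraceScaling`, stmt-QuantumFields-20203; standing disprover `ym-cdisprove-20203-1`, cycle 49; supports the item, refutes nothing)

Lane A's ★★ STIFF block `…InnerModelBlocks.tensorForm_boOrth_le` — the clause (B-ST) of `InnerBOPackageAt` in the slow ⊗ stiff tensor model, in the BO currency the package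
consumes (`PΦ = boProj Φ`, `Φ − PΦ = boOrth Φ`) — reads `T(Φ−PΦ, Φ−PΦ) ≤ λ₀·ρ·μ₁·‖Φ−PΦ‖²` for every `ρ ∈ [max_k r_k, 1]`, `r_k = b_k/(a_k+b_k+π)` the Mehler ratio of
mode `k`, `λ₀ = Π√(π/(a_k+b_k+π))`, `μ₁` a row bound of the slow kernel.  This file translates the tensor stiff ceiling of R61 (`…Negative.TensorGapCeiling`, §5–§6) into that
currency, for SCHUR-EXACT slow kernels (rows `= μ₁ > 0`, finite slow measure `ν ≠ 0` — the case of a Markov/transfer kernel):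
* `tensorStiff_of_boStiff` — BO-stiff at `ρ` ⇒ R61's tensor stiff clause at `θ = 1 − ρ` (fibre-orthogonal `Φ` have `boOrth Φ = Φ`);
* ★★ `boStiff_le` / `boStiff_iff` — `ρ` is admissible iff `r_k ≤ ρ` for EVERY mode: the constant of `tensorForm_boOrth_le` is SHARP (witness `1 ⊗ hR e_k`, R61 §3);
* ★★ `boStiff_ge_vacuum` — with a mode at the vacuum stiff gap `g₀(L) = 2 − 2cos(2π/L)` (lane A's normalisation, `…MehlerScaling`): `ρ ≥ 1 − 2π/L − (2π/L)²`;
* ★★★ `no_uniform_boStiff` — for every `ρ < 1` there is `L₀` beyond which NO slow model admits `ρ`: the stiff block is asymptotically as large as the slow block's Schur bound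
  `λ₀μ₁` — an `L`-UNIFORM contraction `ρ < 1` of the stiff block (the natural strengthening of (B-ST)) is FALSE; `boStiff_half_fails`: `ρ ≤ 1/2` is dead from `L = 9` on.
Consequence for the record (regime (ar)(i) of the disproof file): the Feshbach/Schur-complement step of the inner BO package may use `(1 − ρ)⁻¹` only with `ρ = ρ(L) → 1`,
i.e. with a loss `≍ L/2π` at fixed `L` — harmless at fixed `L` (S-BASE), fatal for any `L`-uniform variant.
HONEST FRAMING: prices a clause of a stub (`InnerBOPackageAt`, lane A of S-BASE) of a child of the CONDITIONAL reduction route R2b1 (Lüscher reduction); it refutes no thesis,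
is not infinite volume, not a mass gap, not Clay.
## References
* M. Lüscher, *Some analytic results concerning the mass spectrum of Yang–Mills gauge theories on a torus*, Nucl. Phys. B219 (1983) 233–261, §3. [Luscher1983]
* B. Helffer, *Spectral Theory and its Applications*, Cambridge UP 2013, Lemma 7.1 (Schur test; equality for constant rows). [Helffer2013]
* A. Wipf, *Statistical Approach to Quantum Field Theory*, 2nd ed., Springer LNP 992 (2021), §8.5.1 (8.57)–(8.58) (oscillator transfer kernel, Mehler ratio). [Wipf2021]
-/

open MeasureTheory Real Filter Topology
open scoped BigOperators

namespace Summit.QuantumFields.YangMills.Theorems.TwistedTraceScaling.Negative.R61B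

open Summit.QuantumFields.YangMills.Theorems.FemtoTransferGap.Mehler
open Summit.QuantumFields.YangMills.Theorems.TwistedTraceScaling.Negative.R60 (data_pos)
open Summit.QuantumFields.YangMills.Theorems.TwistedTraceScaling.Negative.R61 (tensorStiff_le tensorStiff_le_vacuum no_uniform_tensorStiff
  tensorStiff_half_fails)

noncomputable section

variable {C : Type*} [MeasurableSpace C] {ν : Measure C}
variable {σ : Type*} [Fintype σ] [DecidableEq σ]
variable {k : C → C → ℝ} {a b : σ → ℝ} {μ₁ ρ : ℝ}

omit [MeasurableSpace C] in
/-- `PΦ = 0` when every slow coefficient vanishes. [cite: Luscher1983, §3] -/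
theorem boProj_eq_zero {Φ : C × (σ → ℝ) → ℝ} (h0 : ∀ c, slowCoeff Φ c = 0) : boProj Φ = 0 := by
  funext x; simp [boProj, h0]

omit [MeasurableSpace C] in
/-- `Φ − PΦ = Φ` when every slow coefficient vanishes. [cite: Luscher1983, §3] -/
theorem boOrth_eq_self {Φ : C × (σ → ℝ) → ℝ} (h0 : ∀ c, slowCoeff Φ c = 0) : boOrth Φ = Φ := by
  show Φ - boProj Φ = Φ
  rw [boProj_eq_zero h0, sub_zero]

/-- BO-stiff at `ρ` ⇒ the tensor stiff clause of R61 at `θ = 1 − ρ` (stated with the constant `1 − (1 − ρ)` literally, to plug into R61). [cite: Luscher1983, §3] -/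
theorem tensorStiff_of_boStiff
    (hbo : ∀ Φ : C × (σ → ℝ) → ℝ, MemLp Φ 2 (ν.prod volume) →
      tensorForm ν k a b (boOrth Φ) (boOrth Φ) ≤ (∏ i, Real.sqrt (π / (a i + b i + π))) * ρ * μ₁ * ∫ x, boOrth Φ x ^ 2 ∂(ν.prod volume)) :
    ∀ Φ : C × (σ → ℝ) → ℝ, MemLp Φ 2 (ν.prod volume) → (∀ c, slowCoeff Φ c = 0) →
      tensorForm ν k a b Φ Φ ≤ (∏ i, Real.sqrt (π / (a i + b i + π))) * (1 - (1 - ρ)) * μ₁ * ∫ p, Φ p ^ 2 ∂(ν.prod volume) := by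
  intro Φ hΦ h0
  have h := hbo Φ hΦ
  rw [boOrth_eq_self h0] at h
  rwa [sub_sub_cancel]

/-- ★★ **Necessity — the BO stiff constant is sharp**: if `T(Φ−PΦ, Φ−PΦ) ≤ λ₀ρμ₁‖Φ−PΦ‖²` for all `Φ ∈ L²` (Schur-exact slow kernel, rows `= μ₁ > 0`, finite `ν ≠ 0`), then
`r_{k₀} ≤ ρ` for EVERY mode `k₀` (witness `1 ⊗ hR e_{k₀}`, R61 §3/§5). [cite: Luscher1983, §3] [cite: Helffer2013, Lemma 7.1] -/
theorem boStiff_le [IsFiniteMeasure ν] [NeZero ν] (ha : ∀ i, 0 < a i) (hb : ∀ i, 0 < b i) (hab : ∀ i, a i ^ 2 + 2 * a i * b i = π ^ 2)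
    (hk0 : ∀ c c', 0 ≤ k c c') (hksymm : ∀ c c', k c c' = k c' c) (hkm : Measurable (Function.uncurry k)) (hkint : ∀ c, Integrable (k c) ν)
    (hμ₁ : 0 < μ₁) (hkrow : ∀ c, ∫ c', k c c' ∂ν = μ₁)
    (hbo : ∀ Φ : C × (σ → ℝ) → ℝ, MemLp Φ 2 (ν.prod volume) →
      tensorForm ν k a b (boOrth Φ) (boOrth Φ) ≤ (∏ i, Real.sqrt (π / (a i + b i + π))) * ρ * μ₁ * ∫ x, boOrth Φ x ^ 2 ∂(ν.prod volume)) (k₀ : σ) :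
    b k₀ / (a k₀ + b k₀ + π) ≤ ρ := by
  have := tensorStiff_le ha hb hab hk0 hksymm hkm hkint hμ₁ hkrow (tensorStiff_of_boStiff hbo) k₀
  linarith

/-- ★★ **Sufficiency for every `ρ`** (lane A's `tensorForm_boOrth_le` at `min ρ 1`; rows `≤ μ₁`, `μ₁ ≥ 0`). [cite: Luscher1983, §3] [cite: Helffer2013, Lemma 7.1] -/
theorem boStiff_of_le [SFinite ν] (ha : ∀ i, 0 < a i) (hb : ∀ i, 0 < b i) (hab : ∀ i, a i ^ 2 + 2 * a i * b i = π ^ 2)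
    (hk0 : ∀ c c', 0 ≤ k c c') (hksymm : ∀ c c', k c c' = k c' c) (hkm : Measurable (Function.uncurry k)) (hkint : ∀ c, Integrable (k c) ν)
    (hμ₁ : 0 ≤ μ₁) (hkrow : ∀ c, ∫ c', k c c' ∂ν ≤ μ₁) (hρ0 : 0 ≤ ρ) (hρ : ∀ k₀, b k₀ / (a k₀ + b k₀ + π) ≤ ρ)
    {Φ : C × (σ → ℝ) → ℝ} (hΦ : MemLp Φ 2 (ν.prod volume)) :
    tensorForm ν k a b (boOrth Φ) (boOrth Φ) ≤ (∏ i, Real.sqrt (π / (a i + b i + π))) * ρ * μ₁ * ∫ x, boOrth Φ x ^ 2 ∂(ν.prod volume) := by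
  obtain ⟨hs, hl, -⟩ := data_pos ha hb
  have hr1 : ∀ k₀, b k₀ / (a k₀ + b k₀ + π) ≤ min ρ 1 := fun k₀ => by
    refine le_min (hρ k₀) ?_
    rw [div_le_one (hs k₀)]
    linarith [ha k₀, Real.pi_pos]
  have h := tensorForm_boOrth_le ha hb hab (le_min hρ0 zero_le_one) hr1 (min_le_right ρ 1) hk0 hksymm hkm hkint hμ₁ hkrow hΦ
  have hI : 0 ≤ ∫ x, boOrth Φ x ^ 2 ∂(ν.prod volume) := integral_nonneg fun _ => sq_nonneg _
  exact h.trans (mul_le_mul_of_nonneg_right (mul_le_mul_of_nonneg_right (mul_le_mul_of_nonneg_left (min_le_left ρ 1) hl.le) hμ₁) hI)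

/-- ★★ **The admissible BO stiff constants are exactly `[max_k r_k, ∞)`** (Schur-exact kernel, `μ₁ > 0`, finite `ν ≠ 0`, at least one stiff mode): lane A's
`tensorForm_boOrth_le` is sharp. [cite: Luscher1983, §3] [cite: Helffer2013, Lemma 7.1] -/
theorem boStiff_iff [IsFiniteMeasure ν] [NeZero ν] [Nonempty σ] (ha : ∀ i, 0 < a i) (hb : ∀ i, 0 < b i) (hab : ∀ i, a i ^ 2 + 2 * a i * b i = π ^ 2)
    (hk0 : ∀ c c', 0 ≤ k c c') (hksymm : ∀ c c', k c c' = k c' c) (hkm : Measurable (Function.uncurry k)) (hkint : ∀ c, Integrable (k c) ν)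
    (hμ₁ : 0 < μ₁) (hkrow : ∀ c, ∫ c', k c c' ∂ν = μ₁) :
    (∀ Φ : C × (σ → ℝ) → ℝ, MemLp Φ 2 (ν.prod volume) →
      tensorForm ν k a b (boOrth Φ) (boOrth Φ) ≤ (∏ i, Real.sqrt (π / (a i + b i + π))) * ρ * μ₁ * ∫ x, boOrth Φ x ^ 2 ∂(ν.prod volume)) ↔
    ∀ k₀, b k₀ / (a k₀ + b k₀ + π) ≤ ρ := by
  refine ⟨fun hbo k₀ => boStiff_le ha hb hab hk0 hksymm hkm hkint hμ₁ hkrow hbo k₀, fun hρ Φ hΦ => ?_⟩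
  obtain ⟨k₀⟩ := ‹Nonempty σ›
  have hρ0 : 0 ≤ ρ := ((data_pos ha hb).2.2 k₀).le.trans (hρ k₀)
  exact boStiff_of_le ha hb hab hk0 hksymm hkm hkint hμ₁.le (fun c => (hkrow c).le) hρ0 hρ hΦ

/-- ★★ **The BO stiff constant at the vacuum stiff gap**: with a mode normalised at `g₀(L) = 2 − 2cos(2π/L)` (`L > 0`), every admissible `ρ` has
`1 − 2π/L − (2π/L)² ≤ ρ` — the stiff block's contraction `1 − ρ` is at most `2π/L + (2π/L)²`. [cite: Wipf2021, §8.5.1 (8.57)] [cite: Luscher1983, §3] -/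
theorem boStiff_ge_vacuum [IsFiniteMeasure ν] [NeZero ν] (ha : ∀ i, 0 < a i) (hb : ∀ i, 0 < b i) (hab : ∀ i, a i ^ 2 + 2 * a i * b i = π ^ 2)
    (hk0 : ∀ c c', 0 ≤ k c c') (hksymm : ∀ c c', k c c' = k c' c) (hkm : Measurable (Function.uncurry k)) (hkint : ∀ c, Integrable (k c) ν)
    (hμ₁ : 0 < μ₁) (hkrow : ∀ c, ∫ c', k c c' ∂ν = μ₁)
    (hbo : ∀ Φ : C × (σ → ℝ) → ℝ, MemLp Φ 2 (ν.prod volume) →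
      tensorForm ν k a b (boOrth Φ) (boOrth Φ) ≤ (∏ i, Real.sqrt (π / (a i + b i + π))) * ρ * μ₁ * ∫ x, boOrth Φ x ^ 2 ∂(ν.prod volume))
    {L : ℝ} (hL : 0 < L) (k₀ : σ) (hk₀ : b k₀ / (a k₀ + b k₀ + π) = mehlerRatio (2 - 2 * Real.cos (2 * π / L))) :
    1 - 2 * π / L - (2 * π / L) ^ 2 ≤ ρ := by
  have := tensorStiff_le_vacuum ha hb hab hk0 hksymm hkm hkint hμ₁ hkrow (tensorStiff_of_boStiff hbo) hL k₀ hk₀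
  linarith

/-- ★★★ **NO `L`-UNIFORM BO STIFF CONTRACTION.**  For every `ρ < 1` there is `L₀` such that for all `L ≥ L₀`, every finite mode set whose normalised Mehler datum contains a
mode at the vacuum stiff gap `g₀(L)`, and EVERY Schur-exact slow model (finite `ν ≠ 0`, kernel `k ≥ 0` symmetric with rows `= μ₁ > 0`), lane A's stiff block inequality
with constant `ρ` FAILS for some `Φ ∈ L²`.  [cite: Wipf2021, §8.5.1 (8.58)] [cite: Luscher1983, §3] -/
theorem no_uniform_boStiff {ρ : ℝ} (hρ : ρ < 1) :
    ∃ L₀ : ℕ, ∀ L : ℕ, L₀ ≤ L → ∀ (ι : Type) [Fintype ι] [DecidableEq ι] (a b : ι → ℝ),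
      (∀ j, 0 < a j) → (∀ j, 0 < b j) → (∀ j, a j ^ 2 + 2 * a j * b j = π ^ 2) →
      ∀ k₀ : ι, b k₀ / (a k₀ + b k₀ + π) = mehlerRatio (2 - 2 * Real.cos (2 * π / L)) →
      ∀ (C : Type) [MeasurableSpace C] (ν : Measure C) [IsFiniteMeasure ν] [NeZero ν] (k : C → C → ℝ) (μ₁ : ℝ),
      (∀ c c', 0 ≤ k c c') → (∀ c c', k c c' = k c' c) → Measurable (Function.uncurry k) → (∀ c, Integrable (k c) ν) → 0 < μ₁ →
      (∀ c, ∫ c', k c c' ∂ν = μ₁) →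
      ¬ ∀ Φ : C × (ι → ℝ) → ℝ, MemLp Φ 2 (ν.prod volume) →
        tensorForm ν k a b (boOrth Φ) (boOrth Φ) ≤ (∏ i, Real.sqrt (π / (a i + b i + π))) * ρ * μ₁ * ∫ x, boOrth Φ x ^ 2 ∂(ν.prod volume) := by
  obtain ⟨L₀, hL₀⟩ := no_uniform_tensorStiff (θ := 1 - ρ) (by linarith)
  refine ⟨L₀, fun L hL ι _ _ a b ha hb hab k₀ hk₀ C _ ν _ _ k μ₁ hk0 hksymm hkm hkint hμ₁ hkrow hbo => ?_⟩
  exact hL₀ L hL ι a b ha hb hab k₀ hk₀ C ν k μ₁ hk0 hksymm hkm hkint hμ₁ hkrow (tensorStiff_of_boStiff hbo)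

/-- ★★ `ρ ≤ 1/2` is inadmissible from `L = 9` on (any Schur-exact slow model with a mode at `g₀(L)`). [cite: Wipf2021, §8.5.1 (8.58)] [cite: Luscher1983, §3] -/
theorem boStiff_half_fails [IsFiniteMeasure ν] [NeZero ν] (ha : ∀ i, 0 < a i) (hb : ∀ i, 0 < b i) (hab : ∀ i, a i ^ 2 + 2 * a i * b i = π ^ 2)
    (hk0 : ∀ c c', 0 ≤ k c c') (hksymm : ∀ c c', k c c' = k c' c) (hkm : Measurable (Function.uncurry k)) (hkint : ∀ c, Integrable (k c) ν)
    (hμ₁ : 0 < μ₁) (hkrow : ∀ c, ∫ c', k c c' ∂ν = μ₁)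
    {L : ℝ} (hL : 9 ≤ L) (k₀ : σ) (hk₀ : b k₀ / (a k₀ + b k₀ + π) = mehlerRatio (2 - 2 * Real.cos (2 * π / L))) (hρ : ρ ≤ 1 / 2) :
    ¬ ∀ Φ : C × (σ → ℝ) → ℝ, MemLp Φ 2 (ν.prod volume) →
      tensorForm ν k a b (boOrth Φ) (boOrth Φ) ≤ (∏ i, Real.sqrt (π / (a i + b i + π))) * ρ * μ₁ * ∫ x, boOrth Φ x ^ 2 ∂(ν.prod volume) := fun hbo =>
  tensorStiff_half_fails ha hb hab hk0 hksymm hkm hkint hμ₁ hkrow hL k₀ hk₀ (θ := 1 - ρ) (by linarith) (tensorStiff_of_boStiff hbo)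

end

end Summit.QuantumFields.YangMills.Theorems.TwistedTraceScaling.Negative.R61B
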